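import Literature.RepresentationTheory.FiniteGroups.PermutationFunctionsModP
import HarnessLib

/-!
# Additive invariants of finite `p`-torsion `ℤ[G]`-modules, IV: the codimension-one splitting from a
# TRIVIAL QUOTIENT, and the `hH2` package in SUM-ZERO form

Topic `RepresentationTheory/FiniteGroups`; namespace `Literature.RepresentationTheory.FiniteGroups`
(sub-namespace `StableLatticeReduction.Int`, continued).  THEOREMS ONLY (no definition, no named
fact, no `sorry`, no instance).  Sequel of `AdditiveInvariantFiniteModuleHerbrand` (S1, the
codimension-one splitting `additive_eq_add_trivial_of_card_quotient(′)`) and of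
`PermutationFunctionsModP` (the package `additive_permutation_quotient_eq_add_trivial_of_embedding`);
same binder pair `(ψ, hψ)` — `ψ` with strict-implicit instance binders where the consumer needs it,
`hψ` = additivity on short exact sequences whose middle term is FINITE and KILLED BY `p`.

Source (Milne, *Arithmetic Duality Theorems*, I §5, proof of Thm. 5.1, p. 70; Tate in Cassels–Fröhlich
VII §7.3 Cor. 7.4 (b) and §11.4 (the reciprocity law `∑_v inv_v = 0`)): in Tate's computation of the
Brauer term, `H²(G_S(E), E_S)[p]` embeds by the vector of local invariants into the functions on the
places of `E` above `S` with values in `(1/p)ℤ/ℤ`, onto the SUM-ZERO functions; the cokernel is one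
copy of `(1/p)ℤ/ℤ` with TRIVIAL action of `Gal(E/F₀)` because the sum map is Galois-invariant.  The
earlier files split off that trivial line under the hypothesis "a `G`-fixed function lies outside the
image" (equivalently: the image has fewer fixed vectors than the functions), which FAILS when
`Gal(E/F₀) = C_p` acts simply transitively on the places above `S` (the fixed functions are the
constants, which have sum zero since `p • c = 0`).  This file proves the splitting from the weaker and
always-available hypothesis "`G` acts trivially on the quotient", and repackages the `hH2` brick with
`hsum : ∀ x, ∑ s, θ x s = 0` in place of the fixed-vector count.

## What is formalised (`p` a prime; `G` a monoid in §1, a group in §2)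

* `forall_sub_mem_of_fixed_of_card_quotient` — the old hypothesis implies the new one: a fixed vector
  outside a stable `Y` of prime index forces `ρ s x - x ∈ Y`;
* **`additive_eq_add_trivial_of_quotient_trivial`** / **`…_trivial'`** (S1′) — `P` finite killed by
  `p`, `Y ≤ P` stable of index `p`, `ρ s x - x ∈ Y` ⟹ `ψ P = ψ Y + ψ (ℤ/p)` (`ℤ/p` spelled
  `(Representation.trivial ℤ G ℤ).quotient (p • ⊤)` as in `EquivariantSUnitReduction`); the primed
  form takes an arbitrary `Module ℤ P` instance, `ψ` with strict-implicit instance binders and the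
  torsion hypothesis `p • x = 0` in `ℕ`-form;
* `sum_apply_eq_sum_of_perm` — `∑ₛ (τ g f) s = ∑ₛ f s` for `(τ g f)(x) = f (g⁻¹ • x)`;
* **`additive_permutation_quotient_eq_add_trivial_of_embedding_sumZero`** — the PACKAGE: an injective
  `G`-map `θ : X ↪ (Xs → T)` (`#T = p`) of index `p` (`#X · p = p ^ #Xs`) with `∑ₛ θ x s = 0` gives
  `ψ (ℤ[Xs]/p) = ψ X + ψ (ℤ/p)` — conclusion token-identical to the fixed-vector package;
* `additive_permutation_quotient_comp_eq_add_trivial_of_embedding_sumZero` — the same with `G` acting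
  on `Xs` through `e : G →* Γ` (`(τ g f)(x) = f ((e g)⁻¹ • x)`), the permutation module spelled
  `Representation.quotient ((Representation.ofMulAction ℤ Γ Xs).comp e) (p • ⊤) _` (the lane's
  `layerEquiv` currency);
* §3 `natCard_mul_eq_pow_of_onto_sumZero` (`#X · #T = #T ^ #Xs` when `θ : X ↪ (Xs → T)` is ONTO the
  sum-zero functions, `Xs ≠ ∅`) and the ONTO forms
  `additive_permutation_quotient_eq_add_trivial_of_embedding_onto_sumZero` /
  **`additive_permutation_quotient_comp_eq_add_trivial_of_embedding_onto_sumZero`** (PKG″: the index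
  hypothesis replaced by `Nonempty Xs` + `∀ f, ∑ s, f s = 0 → ∃ x, θ x = f`; requested 02:59:38Z).

Written for lane «TATE-EPC-TC» of cell `bsd-eis` (road memo = evidence #54 on
stmt-BirchSwinnertonDyer-19032; lane state #60), brick B8 / FILE D (the `hH2` hypothesis of the
Euler-characteristic assembly), on the request of the FILE D seat (bus 2026-08-29T02:38:21Z).

## References
* J. S. Milne, *Arithmetic Duality Theorems*, 2nd ed. (2006), I §5, proof of Thm. 5.1 (p. 70). [MilneADT2006]
* J. W. S. Cassels, A. Fröhlich (eds.), *Algebraic Number Theory* (1967), Ch. VII (Tate) §7.3 Cor. 7.4 (b),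
  §11.4. [CasselsFrohlichANT1967]
* J.-P. Serre, *Linear Representations of Finite Groups*, GTM 42 (1977), §15.2 Thm. 32.
  [SerreLinearRepresentations1977]
-/

namespace Literature.RepresentationTheory.FiniteGroups

namespace StableLatticeReduction.Int

open Function LinearMap Submodule StableLatticeReduction
open scoped Pointwise

variable {A : Type*} [AddCommGroup A] {p : ℕ}

/-! ### §1. Codimension-one splitting from a TRIVIAL quotient (no fixed vector)

The hypothesis `hfix`/`hinv` of `additive_eq_add_trivial_of_card_quotient(′)` and of the package
above — a `G`-fixed vector OUTSIDE `Y` — fails in the lane's own setting when the decomposition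
group acts simply transitively on the places above `S` (`E/F₀` cyclic of degree `p`, one place of
`F₀` totally split in `E`; `T = ℤ/p`): then `(Xs → T)^G` = the constants, and the image of
`H²(E_S)[p]` is the SUM-ZERO hyperplane, whose fixed vectors are again the constants (`p • c = 0`),
so `#X^G < #(Xs → T)^G` reads `p < p`.  What survives is exactly what Tate's argument uses: the
sum map `Σ : (Xs → T) → T`, `f ↦ ∑ₛ f s`, is `G`-INVARIANT (`∑ₛ f (g⁻¹ s) = ∑ₛ f s`), so the quotient
line `(Xs → T)/ker Σ ≅ T` is the trivial module for free; and at the finite layer the image of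
`H²(E_S)[p]` lies in `ker Σ` by the reciprocity law (the sum of the local invariants of a global
class vanishes).  The theorems below replace "fixed vector outside `Y`" by "`G` acts trivially on
`P/Y`" (`ρ s x - x ∈ Y`), and `hinv` by `hsum : ∀ x, ∑ s, θ x s = 0`. -/

section QuotientTrivial

variable {G : Type} [Monoid G]

/-- The hypotheses of `additive_eq_add_trivial_of_card_quotient` imply those of
`additive_eq_add_trivial_of_quotient_trivial`: if a `G`-fixed vector of `P` lies outside a stable
`Y` of prime index, then `G` acts trivially on `P/Y` (the fixed class generates the quotient).
[cite: MilneADT2006, I §5, proof of Thm. 5.1 (p. 70)] [cite: SerreLinearRepresentations1977, §15.2 Thm. 32] -/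
theorem forall_sub_mem_of_fixed_of_card_quotient [hp : Fact p.Prime] {P : Type} [AddCommGroup P]
    (ρ : Representation ℤ G P) (Y : Submodule ℤ P) (hY : ∀ s, Y ≤ Y.comap (ρ s))
    (hcard : Nat.card (P ⧸ Y) = p) (hfix : ∃ x : P, (∀ s, ρ s x = x) ∧ x ∉ Y) :
    ∀ (s : G) (x : P), ρ s x - x ∈ Y := by
  obtain ⟨x₀, hx₀, hx₀Y⟩ := hfix
  haveI : Fact (Nat.card (P ⧸ Y)).Prime := ⟨hcard.symm ▸ hp.out⟩
  have hq₀ : (Submodule.Quotient.mk x₀ : P ⧸ Y) ≠ 0 := fun h =>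
    hx₀Y ((Submodule.Quotient.mk_eq_zero Y).1 h)
  have hgen : ∀ q : P ⧸ Y, ∃ n : ℤ, n • (Submodule.Quotient.mk x₀ : P ⧸ Y) = q := fun q => by
    have htop : AddSubgroup.zmultiples (Submodule.Quotient.mk x₀ : P ⧸ Y) = ⊤ :=
      ((AddSubgroup.zmultiples _).eq_bot_or_eq_top_of_prime_card).resolve_left
        (fun h => hq₀ ((AddSubgroup.zmultiples_eq_bot).1 h))
    exact (AddSubgroup.mem_zmultiples_iff).1 (htop.symm ▸ AddSubgroup.mem_top q)
  intro s x
  obtain ⟨n, hn⟩ := hgen (Submodule.Quotient.mk x)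
  -- `x = n • x₀ + y` with `y ∈ Y`
  have hy : x - n • x₀ ∈ Y := by
    rw [← Submodule.Quotient.eq, ← hn]
    exact (map_zsmul (Submodule.mkQ Y) n x₀).symm
  have h1 : ρ s (x - n • x₀) ∈ Y := hY s hy
  have h2 : ρ s (x - n • x₀) = ρ s x - n • x₀ := by rw [map_sub, map_zsmul, hx₀ s]
  have : ρ s x - x = ρ s (x - n • x₀) - (x - n • x₀) := by rw [h2]; abel
  rw [this]
  exact Y.sub_mem h1 hy

variable (ψ : ∀ ⦃X : Type⦄ [AddCommGroup X] [Module ℤ X], Representation ℤ G X → A)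
  (hψ : ∀ ⦃X Y Z : Type⦄ [AddCommGroup X] [Module ℤ X] [AddCommGroup Y] [Module ℤ Y]
    [AddCommGroup Z] [Module ℤ Z] (ρX : Representation ℤ G X) (ρY : Representation ℤ G Y)
    (ρZ : Representation ℤ G Z) (f : X →ₗ[ℤ] Y) (g : Y →ₗ[ℤ] Z),
    (∀ s x, f (ρX s x) = ρY s (f x)) → (∀ s y, g (ρY s y) = ρZ s (g y)) →
    Injective f → Surjective g → LinearMap.range f = LinearMap.ker g → Finite Y →
    (∀ y : Y, (p : ℤ) • y = 0) → ψ ρY = ψ ρX + ψ ρZ)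
include hψ

/-- **Codimension-one splitting from a trivial quotient.**  Let `P` be a finite `ℤ[G]`-module
killed by `p`, `Y ≤ P` a `G`-stable submodule of index `p` on whose quotient `G` acts TRIVIALLY
(`ρ s x - x ∈ Y` for all `s`, `x`).  Then `P/Y` is the trivial module `ℤ/p` (a group of prime order,
generated by any non-zero class, with trivial action), so `ψ P = ψ Y + ψ (ℤ/p)` — with `ℤ/p` spelled
`(Representation.trivial ℤ G ℤ).quotient (p • ⊤)` as in `EquivariantSUnitReduction`.  Generalises
`additive_eq_add_trivial_of_card_quotient` (a fixed vector outside `Y` generates `P/Y`, which is then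
trivial); needed when NO fixed vector lies outside `Y` (lane: `Gal(E/F₀) = C_p` simply transitive on
the places above `S`, `Y` = the sum-zero functions).
[cite: MilneADT2006, I §5, proof of Thm. 5.1 (p. 70)] [cite: SerreLinearRepresentations1977, §15.2 Thm. 32] -/
theorem additive_eq_add_trivial_of_quotient_trivial [hp : Fact p.Prime] {P : Type} [AddCommGroup P]
    [Finite P] (ρ : Representation ℤ G P) (hP : ∀ x : P, (p : ℤ) • x = 0) (Y : Submodule ℤ P)
    (hY : ∀ s, Y ≤ Y.comap (ρ s)) (htriv : ∀ (s : G) (x : P), ρ s x - x ∈ Y)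
    (hcard : Nat.card (P ⧸ Y) = p) :
    ψ ρ = ψ (ρ.subrepresentation Y hY) +
      ψ ((Representation.trivial ℤ G ℤ).quotient ((p : ℤ) • ⊤)
        (smul_top_le_comap (Representation.trivial ℤ G ℤ) (p : ℤ))) := by
  obtain ⟨good_sub, good_quot, hψ'⟩ := admissible ψ hψ
  have goodP : Finite P ∧ ∀ x : P, (p : ℤ) • x = 0 := ⟨inferInstance, hP⟩
  have hmem : ∀ {W : Type} [AddCommGroup W] (y : W), y ∈ ((p : ℤ) • ⊤ : Submodule ℤ W) ↔
      ∃ z : W, (p : ℤ) • z = y := fun y => by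
    rw [mem_smul_pointwise_iff_exists]
    exact ⟨fun ⟨z, _, h⟩ => ⟨z, h⟩, fun ⟨z, h⟩ => ⟨z, mem_top, h⟩⟩
  -- `P/Y` has prime order: pick a non-zero class `q₀ = [x₀]`; it generates
  haveI : Fact (Nat.card (P ⧸ Y)).Prime := ⟨hcard.symm ▸ hp.out⟩
  haveI : Finite (P ⧸ Y) := Finite.of_surjective (Submodule.mkQ Y) (mkQ_surjective Y)
  haveI : Nontrivial (P ⧸ Y) :=
    Finite.one_lt_card_iff_nontrivial.1 (hcard.symm ▸ hp.out.one_lt)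
  obtain ⟨q₀, hq₀⟩ := exists_ne (0 : P ⧸ Y)
  obtain ⟨x₀, rfl⟩ := mkQ_surjective Y q₀
  have hgen : ∀ q : P ⧸ Y, ∃ n : ℤ, n • (Submodule.Quotient.mk x₀ : P ⧸ Y) = q := fun q => by
    have htop : AddSubgroup.zmultiples (Submodule.Quotient.mk x₀ : P ⧸ Y) = ⊤ :=
      ((AddSubgroup.zmultiples _).eq_bot_or_eq_top_of_prime_card).resolve_left
        (fun h => hq₀ ((AddSubgroup.zmultiples_eq_bot).1 h))
    exact (AddSubgroup.mem_zmultiples_iff).1 (htop.symm ▸ AddSubgroup.mem_top q)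
  have hord : addOrderOf (Submodule.Quotient.mk x₀ : P ⧸ Y) = p := by
    rcases (Nat.dvd_prime hp.out).1 (hcard ▸ addOrderOf_dvd_natCard _) with h | h
    · exact absurd (AddMonoid.addOrderOf_eq_one_iff.1 h) hq₀
    · exact h
  -- `ℤ/p → P/Y`, `[n] ↦ [n • x₀]`
  have hmk : ∀ n : ℤ, (Submodule.Quotient.mk (n • x₀) : P ⧸ Y) =
      n • (Submodule.Quotient.mk x₀ : P ⧸ Y) := fun n => map_zsmul (Submodule.mkQ Y) n x₀
  let f₀ : ℤ →ₗ[ℤ] P ⧸ Y := Y.mkQ ∘ₗ LinearMap.toSpanSingleton ℤ P x₀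
  have hf₀ : ∀ n : ℤ, f₀ n = Submodule.Quotient.mk (n • x₀) := fun n => rfl
  have hker : ((p : ℤ) • ⊤ : Submodule ℤ ℤ) ≤ LinearMap.ker f₀ := by
    intro n hn
    obtain ⟨m, rfl⟩ := (hmem n).1 hn
    rw [LinearMap.mem_ker, hf₀, smul_eq_mul, mul_comm, mul_smul, hP x₀, smul_zero,
      Submodule.Quotient.mk_zero]
  let f : (ℤ ⧸ ((p : ℤ) • ⊤ : Submodule ℤ ℤ)) →ₗ[ℤ] P ⧸ Y := Submodule.liftQ _ f₀ hker
  have hfmk : ∀ n : ℤ, f (Submodule.Quotient.mk n) = Submodule.Quotient.mk (n • x₀) := fun n => rfl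
  have hfsurj : Surjective f := fun q => by
    obtain ⟨n, hn⟩ := hgen q
    exact ⟨Submodule.Quotient.mk n, ((hfmk n).trans (hmk n)).trans hn⟩
  have hfinj : Injective f := by
    rw [← LinearMap.ker_eq_bot, eq_bot_iff]
    intro c hc
    obtain ⟨n, rfl⟩ := mkQ_surjective _ c
    rw [LinearMap.mem_ker] at hc
    have hc' : n • (Submodule.Quotient.mk x₀ : P ⧸ Y) = 0 :=
      ((hmk n).symm.trans ((hfmk n).symm)).trans hc
    rw [← addOrderOf_dvd_iff_zsmul_eq_zero, hord] at hc'
    obtain ⟨m, rfl⟩ := hc'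
    rw [Submodule.mem_bot]
    exact (Submodule.Quotient.mk_eq_zero _).2 ((hmem _).2 ⟨m, by rw [smul_eq_mul]⟩)
  let e : (ℤ ⧸ ((p : ℤ) • ⊤ : Submodule ℤ ℤ)) ≃ₗ[ℤ] P ⧸ Y :=
    LinearEquiv.ofBijective f ⟨hfinj, hfsurj⟩
  -- equivariance: `G` acts trivially on both sides
  have he : ∀ s c, e (((Representation.trivial ℤ G ℤ).quotient ((p : ℤ) • ⊤)
      (smul_top_le_comap (Representation.trivial ℤ G ℤ) (p : ℤ))) s c) =
      (ρ.quotient Y hY) s (e c) := fun s c => by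
    obtain ⟨n, rfl⟩ := mkQ_surjective _ c
    change (Submodule.Quotient.mk (n • x₀) : P ⧸ Y) = Submodule.Quotient.mk (ρ s (n • x₀))
    rw [eq_comm, Submodule.Quotient.eq]
    exact htriv s (n • x₀)
  rw [Admissible.additive_eq_sub_add_quotient ψ _ hψ' ρ goodP Y hY]
  congr 1
  exact (Admissible.additive_eq_of_linearEquiv ψ _ good_quot hψ' _ (ρ.quotient Y hY)
    (good_quot ρ Y hY goodP) e he).symm

end QuotientTrivial

section QuotientTrivialInstancePolymorphic

variable {G : Type} [Monoid G]
variable (ψ : ∀ ⦃X : Type⦄ ⦃_ : AddCommGroup X⦄ ⦃_ : Module ℤ X⦄, Representation ℤ G X → A)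
  (hψ : ∀ ⦃X Y Z : Type⦄ [AddCommGroup X] [Module ℤ X] [AddCommGroup Y] [Module ℤ Y]
    [AddCommGroup Z] [Module ℤ Z] (ρX : Representation ℤ G X) (ρY : Representation ℤ G Y)
    (ρZ : Representation ℤ G Z) (f : X →ₗ[ℤ] Y) (g : Y →ₗ[ℤ] Z),
    (∀ s x, f (ρX s x) = ρY s (f x)) → (∀ s y, g (ρY s y) = ρZ s (g y)) →
    Injective f → Surjective g → LinearMap.range f = LinearMap.ker g → Finite Y →
    (∀ y : Y, (p : ℤ) • y = 0) → ψ ρY = ψ ρX + ψ ρZ)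
include hψ

/-- **Codimension-one splitting from a trivial quotient, instance-polymorphic form** of
`additive_eq_add_trivial_of_quotient_trivial` (the requested S1′): the `Module ℤ P` structure is an
arbitrary instance binder (e.g. the `isModule` field of a `ModuleCat` cohomology carrier), `ψ` has
strict-implicit instance binders (the Π-type of `StableLatticeReductionInvariantInt`), and the
torsion hypothesis is `p • x = 0` with the canonical `ℕ`-action.  Hypotheses: `Y ≤ P` stable of
index `p` with `ρ s x - x ∈ Y`; conclusion `ψ P = ψ Y + ψ (ℤ/p)`.
[cite: MilneADT2006, I §5, proof of Thm. 5.1 (p. 70)] [cite: SerreLinearRepresentations1977, §15.2 Thm. 32] -/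
theorem additive_eq_add_trivial_of_quotient_trivial' [hp : Fact p.Prime] {P : Type}
    [AddCommGroup P] [instP : Module ℤ P] [Finite P] (ρ : Representation ℤ G P)
    (hP : ∀ x : P, p • x = 0) (Y : Submodule ℤ P) (hY : ∀ s, Y ≤ Y.comap (ρ s))
    (htriv : ∀ (s : G) (x : P), ρ s x - x ∈ Y) (hcard : Nat.card (P ⧸ Y) = p) :
    ψ ρ = ψ (ρ.subrepresentation Y hY) +
      ψ ((Representation.trivial ℤ G ℤ).quotient ((p : ℤ) • ⊤)
        (smul_top_le_comap (Representation.trivial ℤ G ℤ) (p : ℤ))) := by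
  cases Subsingleton.elim instP (AddCommGroup.toIntModule P)
  have hP' : ∀ x : P, (p : ℤ) • x = 0 := fun x => (Nat.cast_smul_eq_nsmul ℤ p x).trans (hP x)
  exact additive_eq_add_trivial_of_quotient_trivial ψ hψ ρ hP' Y hY htriv hcard

end QuotientTrivialInstancePolymorphic

/-! ### §2. The `hH2`-shaped package, SUM-ZERO form (no fixed-vector hypothesis) -/

section PackageSumZero

variable {G : Type} [Group G]

/-- **The sum of the values is `G`-invariant**: for the action `(τ g f)(x) = f (g⁻¹ • x)` on the
functions `Xs → T` on a finite `G`-set, `∑ₛ (τ g f) s = ∑ₛ f s` (reindex along the permutation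
`s ↦ g⁻¹ • s`).  Hence `τ g f - f` has sum zero: `G` acts trivially on `(Xs → T)/(sum-zero functions)`.
[cite: CasselsFrohlichANT1967, Ch. VII §7.3 Cor. 7.4 (b)] [cite: MilneADT2006, I §5, proof of Thm. 5.1 (p. 70)] -/
theorem sum_apply_eq_sum_of_perm (Xs : Type) [Fintype Xs] [MulAction G Xs] {T : Type}
    [AddCommGroup T] [Module ℤ T] (τ : Representation ℤ G (Xs → T))
    (hτ : ∀ (g : G) (f : Xs → T) (x : Xs), τ g f x = f (g⁻¹ • x)) (g : G) (f : Xs → T) :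
    ∑ s, τ g f s = ∑ s, f s :=
  calc ∑ s, τ g f s = ∑ s, f (g⁻¹ • s) := Finset.sum_congr rfl fun s _ => hτ g f s
    _ = ∑ s, f s := Fintype.sum_equiv (MulAction.toPerm (g⁻¹ : G)) _ _ fun _ => rfl

variable (ψ : ∀ ⦃X : Type⦄ ⦃_ : AddCommGroup X⦄ ⦃_ : Module ℤ X⦄, Representation ℤ G X → A)
  (hψ : ∀ ⦃X Y Z : Type⦄ [AddCommGroup X] [Module ℤ X] [AddCommGroup Y] [Module ℤ Y]
    [AddCommGroup Z] [Module ℤ Z] (ρX : Representation ℤ G X) (ρY : Representation ℤ G Y)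
    (ρZ : Representation ℤ G Z) (f : X →ₗ[ℤ] Y) (g : Y →ₗ[ℤ] Z),
    (∀ s x, f (ρX s x) = ρY s (f x)) → (∀ s y, g (ρY s y) = ρZ s (g y)) →
    Injective f → Surjective g → LinearMap.range f = LinearMap.ker g → Finite Y →
    (∀ y : Y, (p : ℤ) • y = 0) → ψ ρY = ψ ρX + ψ ρZ)
include hψ

/-- **The Brauer term of Tate's computation, packaged — SUM-ZERO form.**  Let `Xs` be a finite
`G`-set, `T` an abelian group of order `p`, `τ` the representation `(τ g f)(x) = f (g⁻¹ • x)` on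
`Xs → T`, and `θ : X ↪ (Xs → T)` an injective `G`-map from a finite `ℤ[G]`-module `X` (any `Module ℤ`
instances) of index `p` (`#X · p = p ^ #Xs`) whose values have SUM ZERO (`∑ₛ θ x s = 0`).  Then
`ψ (ℤ[Xs]/p) = ψ X + ψ (ℤ/p)` — conclusion token-identical to
`additive_permutation_quotient_eq_add_trivial_of_embedding`, WITHOUT its hypothesis `hinv` (which
fails for `G = C_p` simply transitive on `Xs`).  Proof: `Σ : f ↦ ∑ₛ f s` is a `G`-invariant surjection
onto `T` (`Xs ≠ ∅` is forced by `hindex`), so `ker Σ` is stable of index `p` with trivial quotient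
action; `θ(X) ⊆ ker Σ` by `hsum`, with equality by the two counts; then
`additive_eq_add_trivial_of_quotient_trivial′` and `additive_pi_eq_permutation_quotient`.  For the
lane: `X = H²(E_S)[p]` at the layer `E`, `θ` = the vector of local invariants, `hsum` = the reciprocity
law `∑_w inv_w = 0` on global classes, `hindex` = the count `#H²(E_S)[p] = p ^ (#S(E) − 1)`.
[cite: MilneADT2006, I §5, proof of Thm. 5.1 (p. 70)] [cite: CasselsFrohlichANT1967, Ch. VII §7.3 Cor. 7.4 (b)] -/
theorem additive_permutation_quotient_eq_add_trivial_of_embedding_sumZero [hp : Fact p.Prime]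
    (Xs : Type) [Fintype Xs] [MulAction G Xs] {T : Type} [AddCommGroup T] [instT : Module ℤ T]
    [Finite T] (hT : Nat.card T = p) (τ : Representation ℤ G (Xs → T))
    (hτ : ∀ (g : G) (f : Xs → T) (x : Xs), τ g f x = f (g⁻¹ • x))
    {X : Type} [AddCommGroup X] [instX : Module ℤ X] [Finite X] (ρX : Representation ℤ G X)
    (θ : X →ₗ[ℤ] (Xs → T)) (hθ : ∀ (g : G) (x : X), θ (ρX g x) = τ g (θ x)) (hinj : Injective θ)
    (hindex : Nat.card X * p = p ^ Fintype.card Xs) (hsum : ∀ x : X, ∑ s, θ x s = 0) :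
    ψ ((Representation.ofMulAction ℤ G Xs).quotient ((p : ℤ) • ⊤)
        (smul_top_le_comap (Representation.ofMulAction ℤ G Xs) (p : ℤ))) =
      ψ ρX + ψ ((Representation.trivial ℤ G ℤ).quotient ((p : ℤ) • ⊤)
        (smul_top_le_comap (Representation.trivial ℤ G ℤ) (p : ℤ))) := by
  cases Subsingleton.elim instT (AddCommGroup.toIntModule T)
  cases Subsingleton.elim instX (AddCommGroup.toIntModule X)
  classical
  obtain ⟨good_sub, good_quot, hψ'⟩ := admissible ψ hψ
  obtain ⟨t₀, -, -, hpT⟩ := exists_generator_of_natCard_eq_prime (p := p) hT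
  have hP : ∀ f : Xs → T, p • f = 0 := fun f => funext fun x => by
    rw [Pi.smul_apply, Pi.zero_apply, hpT]
  -- `Xs` is nonempty: `#X · p = p ^ 0 = 1` is impossible
  have hXs : Nonempty Xs := by
    by_contra h
    rw [not_nonempty_iff] at h
    rw [Fintype.card_eq_zero_iff.2 h, pow_zero] at hindex
    have hle : p ≤ Nat.card X * p := Nat.le_mul_of_pos_left p Nat.card_pos
    rw [hindex] at hle
    exact absurd (hp.out.one_lt.trans_le hle) (lt_irrefl 1)
  obtain ⟨s₀⟩ := hXs
  -- the sum map `σ : f ↦ ∑ s, f s`, a `G`-invariant surjection onto `T`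
  let σ : (Xs → T) →ₗ[ℤ] T :=
    { toFun := fun f => ∑ s, f s
      map_add' := fun f f' => Finset.sum_add_distrib
      map_smul' := fun n f => by rw [RingHom.id_apply, Finset.smul_sum]; rfl }
  have hσ : ∀ f : Xs → T, σ f = ∑ s, f s := fun _ => rfl
  have hστ : ∀ (g : G) (f : Xs → T), σ (τ g f) = σ f := fun g f => by
    rw [hσ, hσ, sum_apply_eq_sum_of_perm Xs τ hτ g f]
  have hσsurj : Surjective σ := fun t =>
    ⟨fun s => if s = s₀ then t else 0, by
      rw [hσ, Finset.sum_ite_eq' Finset.univ s₀ (fun _ => t), if_pos (Finset.mem_univ _)]⟩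
  -- `Y := ker σ`: stable, trivial quotient action, index `p`
  let Y : Submodule ℤ (Xs → T) := LinearMap.ker σ
  have hY : ∀ s, Y ≤ Y.comap (τ s) := fun s f hf => by
    change σ (τ s f) = 0
    rw [hστ]
    exact hf
  have htriv : ∀ (s : G) (f : Xs → T), τ s f - f ∈ Y := fun s f => by
    change σ (τ s f - f) = 0
    rw [map_sub, hστ, sub_self]
  have hcard : Nat.card ((Xs → T) ⧸ Y) = p := by
    rw [Nat.card_congr (LinearMap.quotKerEquivOfSurjective σ hσsurj).toEquiv, hT]
  -- `θ(X) = ker σ`: inclusion by `hsum`, equality by the two counts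
  have hθY : ∀ x : X, θ x ∈ Y := fun x => by
    change σ (θ x) = 0
    rw [hσ, hsum]
  have hcardY : Nat.card Y = Nat.card X := by
    have h := Submodule.card_eq_card_quotient_mul_card Y
    rw [Nat.card_fun, hT, Nat.card_eq_fintype_card, ← hindex, hcard] at h
    -- `h : #X * p = #Y * p`
    exact (Nat.eq_of_mul_eq_mul_right hp.out.pos h).symm
  let θ' : X →ₗ[ℤ] Y := LinearMap.codRestrict Y θ hθY
  have hθ'inj : Injective θ' := fun x x' h => hinj (congrArg Subtype.val h)
  have hθ'bij : Function.Bijective θ' := hθ'inj.bijective_of_nat_card_le hcardY.le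
  let e : X ≃ₗ[ℤ] Y := LinearEquiv.ofBijective θ' hθ'bij
  have he : ∀ s x, e (ρX s x) = (τ.subrepresentation Y hY) s (e x) := fun s x =>
    Subtype.ext (hθ s x)
  have goodY : Finite Y ∧ ∀ y : Y, (p : ℤ) • y = 0 :=
    ⟨inferInstance, fun y => Subtype.ext ((natCast_zsmul (y : Xs → T) p).trans (hP y))⟩
  have hψY : ψ ρX = ψ (τ.subrepresentation Y hY) :=
    Admissible.additive_eq_of_linearEquiv ψ _ good_quot hψ' ρX _ goodY e he
  -- assemble: S1′ on `(Xs → T) ⊇ ker σ`, then identify the functions with `ℤ[Xs]/p`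
  have hS1 := additive_eq_add_trivial_of_quotient_trivial' ψ hψ τ hP Y hY htriv hcard
  rw [← additive_pi_eq_permutation_quotient ψ hψ Xs hT τ hτ, hS1, hψY]

/-- **The sum-zero package, PULLED-BACK form** (the consumer's currency: `G` acts on the finite set
`Xs` through a homomorphism `e : G →* Γ` into the group that owns the action — lane: `Δ = U/W`
acting on the places above `S` of the layer `E` through `layerEquiv : Δ ≃* Gal(E/F₀)`).  With
`(τ g f)(x) = f ((e g)⁻¹ • x)` and the other hypotheses of
`additive_permutation_quotient_eq_add_trivial_of_embedding_sumZero` verbatim, the permutation module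
is spelled `Representation.quotient ((Representation.ofMulAction ℤ Γ Xs).comp e) (p • ⊤) _`.
Proof: this representation IS `Representation.ofMulAction ℤ G Xs` for the pulled-back action
`MulAction.compHom Xs e` (definitionally), to which the previous theorem applies.
[cite: MilneADT2006, I §5, proof of Thm. 5.1 (p. 70)] [cite: CasselsFrohlichANT1967, Ch. VII §7.3 Cor. 7.4 (b)] -/
theorem additive_permutation_quotient_comp_eq_add_trivial_of_embedding_sumZero [hp : Fact p.Prime]
    {Γ : Type*} [Group Γ] (e : G →* Γ) (Xs : Type) [Fintype Xs] [MulAction Γ Xs] {T : Type}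
    [AddCommGroup T] [instT : Module ℤ T] [Finite T] (hT : Nat.card T = p)
    (τ : Representation ℤ G (Xs → T))
    (hτ : ∀ (g : G) (f : Xs → T) (x : Xs), τ g f x = f ((e g)⁻¹ • x))
    {X : Type} [AddCommGroup X] [instX : Module ℤ X] [Finite X] (ρX : Representation ℤ G X)
    (θ : X →ₗ[ℤ] (Xs → T)) (hθ : ∀ (g : G) (x : X), θ (ρX g x) = τ g (θ x)) (hinj : Injective θ)
    (hindex : Nat.card X * p = p ^ Fintype.card Xs) (hsum : ∀ x : X, ∑ s, θ x s = 0) :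
    ψ (Representation.quotient ((Representation.ofMulAction ℤ Γ Xs).comp e) ((p : ℤ) • ⊤)
        (smul_top_le_comap ((Representation.ofMulAction ℤ Γ Xs).comp e) (p : ℤ))) =
      ψ ρX + ψ ((Representation.trivial ℤ G ℤ).quotient ((p : ℤ) • ⊤)
        (smul_top_le_comap (Representation.trivial ℤ G ℤ) (p : ℤ))) := by
  letI : MulAction G Xs := MulAction.compHom Xs e
  have hτ' : ∀ (g : G) (f : Xs → T) (x : Xs), τ g f x = f (g⁻¹ • x) := fun g f x => by
    rw [hτ, MulAction.compHom_smul_def, map_inv]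
  -- `(ofMulAction ℤ Γ Xs).comp e` is definitionally `ofMulAction ℤ G Xs` for the pulled-back action
  exact additive_permutation_quotient_eq_add_trivial_of_embedding_sumZero ψ hψ Xs hT τ hτ'
    ρX θ hθ hinj hindex hsum

end PackageSumZero

/-! ### §3. The package in ONTO form: `θ : X ⥲ {sum-zero functions}` (no count hypothesis)

In the lane the index hypothesis `#X · p = p ^ #Xs` is itself proved by REALISING every sum-zero
family of invariants (`SUnitsLayerInvariantsRealisation.exists_layer_realisation`); the form below
takes that surjectivity statement directly and derives the count inside
(`θ : X ≃ ker Σ`, `Σ` onto `T` for `Xs ≠ ∅`, `#(Xs → T) = #T ^ #Xs`). -/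

section PackageOnto

variable {G : Type} [Group G]

/-- **The count from the realisation**: an injective `θ : X → (Xs → T)` (`T` finite, `Xs` a non-empty
finite type) whose image is EXACTLY the sum-zero functions has index `#T`:
`#X · #T = #T ^ #Xs`. [cite: CasselsFrohlichANT1967, Ch. VII §11.4] [cite: NeukirchSchmidtWingberg2008, (8.3.11) (ii)/(iii)] -/
theorem natCard_mul_eq_pow_of_onto_sumZero (Xs : Type) [Fintype Xs] {T : Type} [AddCommGroup T]
    [Finite T] {X : Type} (θ : X → (Xs → T)) (hinj : Injective θ) (hne : Nonempty Xs)
    (hsurj : ∀ f : Xs → T, ∑ s, f s = 0 → ∃ x : X, θ x = f) (hsum : ∀ x : X, ∑ s, θ x s = 0) :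
    Nat.card X * Nat.card T = Nat.card T ^ Fintype.card Xs := by
  classical
  obtain ⟨s₀⟩ := hne
  -- the sum map `σ : f ↦ ∑ s, f s`, an additive surjection onto `T`
  let σ : (Xs → T) →+ T :=
    { toFun := fun f => ∑ s, f s
      map_zero' := Finset.sum_const_zero
      map_add' := fun f f' => Finset.sum_add_distrib }
  have hσ : ∀ f : Xs → T, σ f = ∑ s, f s := fun _ => rfl
  have hσsurj : Surjective σ := fun t =>
    ⟨fun s => if s = s₀ then t else 0, by
      rw [hσ, Finset.sum_ite_eq' Finset.univ s₀ (fun _ => t), if_pos (Finset.mem_univ _)]⟩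
  -- `X ≃ ker σ` via `θ`
  have hmem : ∀ x : X, θ x ∈ σ.ker := fun x => by rw [AddMonoidHom.mem_ker, hσ, hsum]
  let e : X ≃ σ.ker := Equiv.ofBijective (fun x => ⟨θ x, hmem x⟩)
    ⟨fun x x' h => hinj (congrArg Subtype.val h), fun ⟨f, hf⟩ => by
      obtain ⟨x, rfl⟩ := hsurj f (by rwa [AddMonoidHom.mem_ker, hσ] at hf)
      exact ⟨x, rfl⟩⟩
  have h := AddSubgroup.card_eq_card_quotient_mul_card_addSubgroup σ.ker
  rw [Nat.card_congr (QuotientAddGroup.quotientKerEquivOfSurjective σ hσsurj).toEquiv,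
    ← Nat.card_congr e, Nat.card_fun, Nat.card_eq_fintype_card (α := Xs), mul_comm] at h
  exact h.symm

variable (ψ : ∀ ⦃X : Type⦄ ⦃_ : AddCommGroup X⦄ ⦃_ : Module ℤ X⦄, Representation ℤ G X → A)
  (hψ : ∀ ⦃X Y Z : Type⦄ [AddCommGroup X] [Module ℤ X] [AddCommGroup Y] [Module ℤ Y]
    [AddCommGroup Z] [Module ℤ Z] (ρX : Representation ℤ G X) (ρY : Representation ℤ G Y)
    (ρZ : Representation ℤ G Z) (f : X →ₗ[ℤ] Y) (g : Y →ₗ[ℤ] Z),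
    (∀ s x, f (ρX s x) = ρY s (f x)) → (∀ s y, g (ρY s y) = ρZ s (g y)) →
    Injective f → Surjective g → LinearMap.range f = LinearMap.ker g → Finite Y →
    (∀ y : Y, (p : ℤ) • y = 0) → ψ ρY = ψ ρX + ψ ρZ)
include hψ

/-- **The sum-zero package, ONTO form (PKG″ un-pulled-back).**  As
`additive_permutation_quotient_eq_add_trivial_of_embedding_sumZero`, with the index hypothesis
`#X · p = p ^ #Xs` REPLACED by `Xs ≠ ∅` and "every sum-zero function is a value of `θ`"
(`hsurj : ∀ f, ∑ s, f s = 0 → ∃ x, θ x = f`); the count is derived by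
`natCard_mul_eq_pow_of_onto_sumZero`.
[cite: MilneADT2006, I §5, proof of Thm. 5.1 (p. 70)] [cite: CasselsFrohlichANT1967, Ch. VII §7.3 Cor. 7.4 (b), §11.4] -/
theorem additive_permutation_quotient_eq_add_trivial_of_embedding_onto_sumZero [hp : Fact p.Prime]
    (Xs : Type) [Fintype Xs] [MulAction G Xs] {T : Type} [AddCommGroup T] [instT : Module ℤ T]
    [Finite T] (hT : Nat.card T = p) (τ : Representation ℤ G (Xs → T))
    (hτ : ∀ (g : G) (f : Xs → T) (x : Xs), τ g f x = f (g⁻¹ • x))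
    {X : Type} [AddCommGroup X] [instX : Module ℤ X] [Finite X] (ρX : Representation ℤ G X)
    (θ : X →ₗ[ℤ] (Xs → T)) (hθ : ∀ (g : G) (x : X), θ (ρX g x) = τ g (θ x)) (hinj : Injective θ)
    (hne : Nonempty Xs) (hsurj : ∀ f : Xs → T, ∑ s, f s = 0 → ∃ x : X, θ x = f)
    (hsum : ∀ x : X, ∑ s, θ x s = 0) :
    ψ ((Representation.ofMulAction ℤ G Xs).quotient ((p : ℤ) • ⊤)
        (smul_top_le_comap (Representation.ofMulAction ℤ G Xs) (p : ℤ))) =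
      ψ ρX + ψ ((Representation.trivial ℤ G ℤ).quotient ((p : ℤ) • ⊤)
        (smul_top_le_comap (Representation.trivial ℤ G ℤ) (p : ℤ))) := by
  have hindex : Nat.card X * p = p ^ Fintype.card Xs := by
    have h := natCard_mul_eq_pow_of_onto_sumZero Xs θ hinj hne hsurj hsum
    rwa [hT] at h
  exact additive_permutation_quotient_eq_add_trivial_of_embedding_sumZero ψ hψ Xs hT τ hτ ρX θ hθ
    hinj hindex hsum

/-- **PKG″ — the sum-zero package, ONTO and PULLED-BACK form** (the FILE D consumer's currency: `G`
acts on `Xs` through `e : G →* Γ`, `(τ g f)(x) = f ((e g)⁻¹ • x)`, permutation module spelled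
`Representation.quotient ((Representation.ofMulAction ℤ Γ Xs).comp e) (p • ⊤) _`): as
`additive_permutation_quotient_comp_eq_add_trivial_of_embedding_sumZero` with `hindex` REPLACED by
`(hne : Nonempty Xs) (hsurj : ∀ f, ∑ s, f s = 0 → ∃ x, θ x = f)`.  Lane reading: `hsurj` = the
REALISATION of every sum-zero `p`-torsion family of local invariants by a class of `H²(E_S)[p]`
(`exists_layer_realisation`), `hsum` = reciprocity, `hinj` = classes are detected by their invariants.
[cite: MilneADT2006, I §5, proof of Thm. 5.1 (p. 70)] [cite: CasselsFrohlichANT1967, Ch. VII §7.3 Cor. 7.4 (b), §11.4] -/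
theorem additive_permutation_quotient_comp_eq_add_trivial_of_embedding_onto_sumZero
    [hp : Fact p.Prime] {Γ : Type*} [Group Γ] (e : G →* Γ) (Xs : Type) [Fintype Xs]
    [MulAction Γ Xs] {T : Type} [AddCommGroup T] [instT : Module ℤ T] [Finite T]
    (hT : Nat.card T = p) (τ : Representation ℤ G (Xs → T))
    (hτ : ∀ (g : G) (f : Xs → T) (x : Xs), τ g f x = f ((e g)⁻¹ • x))
    {X : Type} [AddCommGroup X] [instX : Module ℤ X] [Finite X] (ρX : Representation ℤ G X)
    (θ : X →ₗ[ℤ] (Xs → T)) (hθ : ∀ (g : G) (x : X), θ (ρX g x) = τ g (θ x)) (hinj : Injective θ)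
    (hne : Nonempty Xs) (hsurj : ∀ f : Xs → T, ∑ s, f s = 0 → ∃ x : X, θ x = f)
    (hsum : ∀ x : X, ∑ s, θ x s = 0) :
    ψ (Representation.quotient ((Representation.ofMulAction ℤ Γ Xs).comp e) ((p : ℤ) • ⊤)
        (smul_top_le_comap ((Representation.ofMulAction ℤ Γ Xs).comp e) (p : ℤ))) =
      ψ ρX + ψ ((Representation.trivial ℤ G ℤ).quotient ((p : ℤ) • ⊤)
        (smul_top_le_comap (Representation.trivial ℤ G ℤ) (p : ℤ))) := by
  have hindex : Nat.card X * p = p ^ Fintype.card Xs := by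
    have h := natCard_mul_eq_pow_of_onto_sumZero Xs θ hinj hne hsurj hsum
    rwa [hT] at h
  exact additive_permutation_quotient_comp_eq_add_trivial_of_embedding_sumZero ψ hψ e Xs hT τ hτ ρX
    θ hθ hinj hindex hsum

end PackageOnto

end StableLatticeReduction.Int

end Literature.RepresentationTheory.FiniteGroups
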